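import Literature.Computability.MetaComplexity.Hirahara2020.ReadOnceBranchingProgramsDL
import Literature.Computability.MetaComplexity.Hirahara2020.SmallBPYesDisjoint
import HarnessLib

/-!
# R28 bookkeeping: the NON-DISJOINT BRANCH of Hirahara's Thm. 1.13 in the two renderings (PROVED)

Hirahara (ToC 19(4) 2023) phrases Thm. 1.13 over a promise problem `(Π_YES, Π_NO) :=
(DSPACE(cn)/ₙ cn vs S̃IZE(2^{αn}; 2^{−ραn}))` that is NON-disjoint in general, and proves it by
contraposition (p. 45 L2–9: a failure of the hitting-set conclusion yields *"a coRP-type randomized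
read-once branching program that solves (Π_YES, Π_NO)"*).  Consequently the theorem has two
branches: if the problem is non-disjoint at all large lengths, NOTHING (co-)solves it there, the
lower-bound hypothesis holds for the trivial reason, and the conclusion follows; otherwise the
hypothesis is a genuine read-once lower bound.  This file records, with proofs only (no definition,
no named fact), how the two tree renderings of row R28 sit with respect to that branch:

* `NondetBranchingProgram.not_coSolves_of_mem_yes_no` — a string of the right length in both
  promise sides defeats every co-solver (one line from the definition of `CoSolves`);
* rendering (II), `dlYes` (D13, `Hirahara2020/ReadOnceBranchingProgramsDL.lean`):
  `Thm113HypothesisDL_of_eventually_nonDisjoint` — eventual non-disjointness of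
  `DSPACEdlVsApproxSIZE c α ρ` gives `Thm113HypothesisDL ρ α β c` for EVERY `β`, and
  `hsg_of_eventually_nonDisjoint_dl` — with the named fact `thm113_dl` this is the non-disjoint
  branch in full: non-disjointness for every `ρ > 0` (some `α > 0`, some `c`) already yields
  `LogspaceHSGvsLinearROBP`.  Whether rendering (II) IS non-disjoint is a circuit lower bound for
  bounded-hardware linear-space machines and is not claimed;
* rendering (I), `smallBPYes` (`Hirahara2020/ReadOnceBranchingPrograms.lean`): the same
  implication `Thm113Hypothesis_of_eventually_nonDisjoint` holds formally, but its hypothesis is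
  NEVER met — `not_frequently_nonDisjoint_smallBPYes` (from `SmallBPYesDisjoint.lean`: for `α > 0`
  the problem is eventually disjoint, so it is not even infinitely often non-disjoint).  Rendering
  (I) therefore has only the genuine-lower-bound branch (referee F34/F36, census IV docstring).

Nothing here bears on the summit; it is census bookkeeping for row R28.
-/

namespace Literature.Computability.MetaComplexity

open Filter
open Literature.Computability.Complexity

/-- A string of length `N` lying in BOTH promise sides defeats every co-solver at length `N`
(it would have to be accepted and rejected). [folklore] -/
theorem NondetBranchingProgram.not_coSolves_of_mem_yes_no {N : ℕ} (P : NondetBranchingProgram N)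
    {Q : PromiseProblem} {x : List Bool} (hx : x.length = N) (hy : x ∈ Q.yes) (hn : x ∈ Q.no) :
    ¬ P.CoSolves Q :=
  fun h => (h x hx).2 hy ((h x hx).1 hn)

namespace Hirahara2020

/-- **Non-disjoint branch, rendering (II).** If `DSPACEdlVsApproxSIZE c α ρ` has, at every large
`n`, a string of length `2^n` in both sides, then the read-once lower-bound hypothesis
`Thm113HypothesisDL ρ α β c` holds for every `β` — trivially, no program of any size co-solves.
[cite: Hirahara2023NonDisjoint, §4.8 proof of Thm. 1.13 (p. 45 L2–9), reading] -/
theorem Thm113HypothesisDL_of_eventually_nonDisjoint {ρ α β : ℝ} {c : ℕ}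
    (h : ∀ᶠ n : ℕ in atTop, ∃ x : List Bool,
      x.length = 2 ^ n ∧ x ∈ dlYes c ∧ x ∈ approxHardNo α ρ) :
    Thm113HypothesisDL ρ α β c := by
  filter_upwards [h] with n hn P _ _
  obtain ⟨x, hx, hy, hno⟩ := hn
  exact P.not_coSolves_of_mem_yes_no hx hy hno

/-- **The non-disjoint branch in full (rendering (II)).** Under the named fact `thm113_dl`: if for
every `ρ > 0` some member `DSPACEdlVsApproxSIZE c α ρ` (`α > 0`) is non-disjoint at all large
lengths, the hitting-set conclusion `LogspaceHSGvsLinearROBP` follows (take `β = 1`).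
[cite: Hirahara2023NonDisjoint, Thm. 1.13 (p. 44) with §4.8 (p. 45 L2–9), reading] -/
theorem hsg_of_eventually_nonDisjoint_dl (hT : thm113_dl)
    (h : ∀ ρ : ℝ, 0 < ρ → ∃ α : ℝ, 0 < α ∧ ∃ c : ℕ, ∀ᶠ n : ℕ in atTop, ∃ x : List Bool,
      x.length = 2 ^ n ∧ x ∈ dlYes c ∧ x ∈ approxHardNo α ρ) :
    LogspaceHSGvsLinearROBP := by
  obtain ⟨ρ, hρ, hT⟩ := hT
  obtain ⟨α, hα, c, hc⟩ := h ρ hρ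
  exact hT α 1 hα one_pos c (Thm113HypothesisDL_of_eventually_nonDisjoint hc)

/-- **Non-disjoint branch, rendering (I)** — the same implication, formally.
[cite: Hirahara2023NonDisjoint, §4.8 proof of Thm. 1.13 (p. 45 L2–9), reading] -/
theorem Thm113Hypothesis_of_eventually_nonDisjoint {ρ α β : ℝ} {c : ℕ}
    (h : ∀ᶠ n : ℕ in atTop, ∃ x : List Bool,
      x.length = 2 ^ n ∧ x ∈ smallBPYes c ∧ x ∈ approxHardNo α ρ) :
    Thm113Hypothesis ρ α β c := by
  filter_upwards [h] with n hn P _ _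
  obtain ⟨x, hx, hy, hno⟩ := hn
  exact P.not_coSolves_of_mem_yes_no hx hy hno

/-- **… but rendering (I) never takes that branch**: for `α > 0` the problem
`DSPACEvsApproxSIZE c α ρ` is not even infinitely often non-disjoint (it is eventually disjoint,
`eventually_smallBPYes_disjoint_approxHardNo`). [folklore] -/
theorem not_frequently_nonDisjoint_smallBPYes (c : ℕ) {α : ℝ} (hα : 0 < α) (ρ : ℝ) :
    ¬ ∃ᶠ n : ℕ in atTop, ∃ x : List Bool,
      x.length = 2 ^ n ∧ x ∈ smallBPYes c ∧ x ∈ approxHardNo α ρ := by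
  rw [Filter.not_frequently]
  filter_upwards [eventually_smallBPYes_disjoint_approxHardNo c hα ρ] with n hn
  rintro ⟨x, hx, hy, hno⟩
  exact hn x hx hy hno

/-- In particular the hypothesis of `Thm113Hypothesis_of_eventually_nonDisjoint` is unsatisfiable
for `α > 0`: in rendering (I) the lower-bound hypothesis can only hold as a genuine lower bound.
[folklore] -/
theorem not_eventually_nonDisjoint_smallBPYes (c : ℕ) {α : ℝ} (hα : 0 < α) (ρ : ℝ) :
    ¬ ∀ᶠ n : ℕ in atTop, ∃ x : List Bool,
      x.length = 2 ^ n ∧ x ∈ smallBPYes c ∧ x ∈ approxHardNo α ρ :=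
  fun h => not_frequently_nonDisjoint_smallBPYes c hα ρ h.frequently

end Hirahara2020

end Literature.Computability.MetaComplexity
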